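import Summits.QuantumFields.BalabanUV.Beta.D1BFx.RestKernelFPSlot
import Summits.QuantumFields.BalabanUV.Beta.D1BFx.PackedColumnEnvelope
import Summits.QuantumFields.BalabanUV.Beta.D1BFx.BondTreeGaugeSharp

/-!
# `BalabanUV.Beta.D1BFx.RestKernelFPSlotRoad` — road «BF-x» for binder row D1, slot (K): **«FP SLOT PACK AT THE ROAD — NO LETTER»** — leaf-01 g23's
# «FP SLOT PACK» `RestKernelFPSlot.END_rows_RkFP` (the END's `hMR` ∕ `hRu` ∕ `hU` ∕ unit rows of the member family `RkFP 𝓻 𝓌` on DISPLAYED per-scale letters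
# `Λ n`, `Cw n`, `cw`) with ALL THREE LETTER BINDERS DISCHARGED at the road's weights `𝓌 n := colH (coDressKBmAt (toSite (𝓻 n)) n (KInvStep n 0)) n` (`dite`-total):
# `hΛ` by gan24-leaf-05's «BMF-SHARP» (`Λ := 2`), `hw` by «G0-COL-ENV» (`Cw n := (n⁴)⁻¹·C_{G₀}` at the coarse rate `δ₀ := κ∕16`, `κ = kappa163 4`), the units line
# `Λ n·Cw n·n⁴ ≤ cw := 2·C_{G₀}` by arithmetic.  What stays displayed: the per-scale in-block roots `𝓻 (m+1) ∈ box 4 (m+1)` (a choice, not an estimate).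

HONEST DEPENDENCY (cell records, verbatim): «continuum YM on T⁴ ⇐ BetaPertH ∧ nine spine estimates (0/9 proved); BetaPertH ⇐ (D1) ∧ (D4) ∧
CAP+tail; G-an2-4 gates asym, D1 and NE2/3/4.»  HONEST FRAMING (cell contract, verbatim): «discharging `BetaPertH` makes Bałaban's UV stability
UNCONDITIONAL — a real constructive-QFT result; it is NOT the continuum limit and NOT the Clay problem.»  THIS MODULE DISCHARGES NOTHING of the
wall: [folklore] composition BY NAME (one `field_simp` for the rate `κ∕16∕(m+1) = κ∕4∕(4(m+1))`, one for the units line).  It closes the LETTERS of ONE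
member family of the (K) slot's (II) ledger; no definition, no `def … : Prop`, nothing cited, 0 sorry.  0 root-level binders of row D1 discharged (hW ∕ hR-sockets ∕
hSX-socket ∕ D1Tel ∕ D1Rep — 0); (K) NOT closed; NOT D1, NOT `BetaPertH`, NOT continuum, NOT Clay.

ABSOLUTE RULE (cell charter, verbatim): «No internally-minted statement may enter as a cited fact. Every hypothesis is either kernel-proved in
this package or a verbatim quotation of a PUBLISHED theorem with page reference. The manuscript(s) under audit are NOT citable for their own
disputed steps — they are the thing under adjudication; programme-internal (2001/route/tribunal) claims are never citable.»

CONTENT (all [folklore]): `colH_G₀_weight_rate` (the «G0-COL-ENV» letter in the slot pack's rate form `δ₀∕(m+1)`, `δ₀ := κ∕16`), `units_line_G₀`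
(`2·((m+1)⁴)⁻¹·C_{G₀}·(m+1)⁴ ≤ 2·C_{G₀}`), **`rows_RkFP_road`**, **`END_rows_RkFP_road`** (`CU := CUfp (κ∕16) (2·C_{G₀}) C_{G₀}`, n-free).
Unit `b2b-balaban-beta-d1-formalise-leaf-04` (gen 20), road «BF-x»; letters by `b2b-balaban-gan24-formalise-leaf-05` (gen 53), packaging by `…-leaf-01` (gen 23).
-/

noncomputable section

open scoped BigOperators
open Literature.MathematicalPhysics.QuantumFieldTheory.Balaban1983to89
open Literature.MathematicalPhysics.QuantumFieldTheory.Balaban1983to89.Beta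
open B12Sec2to5 (l1)
open B5Hk163Strip (kappa163 kappa163_pos)
open B5Hk163Decay (MG163)
open B4TorusKernel (periodConst)
open DecimatedMomentSummable (AbsMoment₂)
open AffineAveraging (box toSite)
open KKTFluctuationKernel (delta1)
open OneStepKernelFamily (KInvStep colH)
open Summit.QuantumFields.BalabanUV.Beta.AxialProjectorBlockMean (bmGaugeAt)
open Summit.QuantumFields.BalabanUV.Beta.AxialDressingRooted (coDressKBmAt)
open Summit.QuantumFields.BalabanUV.Beta.D1BFx.RestKernelFPSlot (RkFP CUfp rows_RkFP END_rows_RkFP)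
open Summit.QuantumFields.BalabanUV.Beta.D1BFx.PackedColumnEnvelope (abs_colH_G₀_road_le colH_G₀_road_weight_nonneg)
open Summit.QuantumFields.BalabanUV.Beta.D1BFx.BondTreeGaugeSharp (abs_bmGaugeAt_delta1_le_two)

namespace Summit.QuantumFields.BalabanUV.Beta.D1BFx.RestKernelFPSlotRoad

/-- [folklore] **THE «G0-COL-ENV» LETTER IN THE SLOT PACK's RATE FORM**: `|colH G₀ (m+1) κ′ v κ u| ≤ ((m+1)⁴)⁻¹·C_{G₀}·e^{−((κ∕16)∕(m+1))·|u − (m+1)•v|₁}`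
(`abs_colH_G₀_road_le`'s exponent `κ∕4∕(4(m+1))` rewritten). -/
theorem colH_G₀_weight_rate (m : ℕ) {r : Fin (3 + 1) → ℕ} (hr : r ∈ box (3 + 1) (m + 1)) (κ' : Fin 4) (v : Fin 4 → ℤ) (κ : Fin 4) (u : Fin 4 → ℤ) :
    |colH (coDressKBmAt (toSite r) (m + 1) (KInvStep (d := 3) (m + 1) 0)) (m + 1) κ' v κ u|
      ≤ ((((m + 1 : ℕ) : ℝ) ^ 4)⁻¹ * ((MG163 4 * periodConst (kappa163 4) 3) * (1 + 8 * (1 + Real.exp (kappa163 4 / 4))) * Real.exp (kappa163 4 / 4)))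
        * Real.exp (-(kappa163 4 / 16 / ((m + 1 : ℕ) : ℝ)) * l1 (u - ((m + 1 : ℕ) : ℤ) • v)) := by
  have h := abs_colH_G₀_road_le m hr κ' v κ u
  have hn : (0 : ℝ) < ((m + 1 : ℕ) : ℝ) := Nat.cast_pos.mpr (Nat.succ_pos m)
  have e : kappa163 4 / 4 / (4 * ((m + 1 : ℕ) : ℝ)) = kappa163 4 / 16 / ((m + 1 : ℕ) : ℝ) := by field_simp; ring
  rw [e] at h
  exact h

/-- [folklore] **THE UNITS LINE AT THE ROAD**: `2·(((m+1)⁴)⁻¹·C_{G₀})·(m+1)⁴ ≤ 2·C_{G₀}` (an equality). -/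
theorem units_line_G₀ (m : ℕ) :
    2 * ((((m + 1 : ℕ) : ℝ) ^ 4)⁻¹ * ((MG163 4 * periodConst (kappa163 4) 3) * (1 + 8 * (1 + Real.exp (kappa163 4 / 4))) * Real.exp (kappa163 4 / 4)))
        * (((m + 1 : ℕ) : ℝ)) ^ 4
      ≤ 2 * ((MG163 4 * periodConst (kappa163 4) 3) * (1 + 8 * (1 + Real.exp (kappa163 4 / 4))) * Real.exp (kappa163 4 / 4)) := by
  have hn : (0 : ℝ) < ((m + 1 : ℕ) : ℝ) ^ 4 := pow_pos (Nat.cast_pos.mpr (Nat.succ_pos m)) 4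
  refine le_of_eq ?_
  field_simp

variable {𝓻 : ℕ → Fin (3 + 1) → ℕ} {μ ν : Fin 4}

/-- [folklore] **THE FP LANE's ROWS AT THE ROAD's WEIGHTS — NO ANALYTIC LETTER**: for per-scale in-block roots `𝓻 (m+1) ∈ box 4 (m+1)`, the member
`RkFP 𝓻 𝓌_{G₀}` (`𝓌_{G₀} n := colH (coDressKBmAt (toSite (𝓻 n)) n (KInvStep n 0)) n` for `n ≠ 0`, `0` at the junk size — a `dite`, `KInvStep` needing `NeZero n`) has, at
every `n ≥ 1`, an absolutely summable second moment and
`|secondMoment (…) μ ν| ≤ CUfp (κ∕16) (2·C_{G₀}) C_{G₀} ()` (leaf-01's `rows_RkFP` at `Λ := 2`, `Cw n := (n⁴)⁻¹·C_{G₀}`, `Cw₀ := C_{G₀}`, `cw := 2·C_{G₀}`, `δ₀ := κ∕16`). -/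
theorem rows_RkFP_road (hr : ∀ m : ℕ, 𝓻 (m + 1) ∈ box (3 + 1) (m + 1)) :
    ∀ (u : Unit) (n : ℕ), 1 ≤ n →
      AbsMoment₂ (RkFP 𝓻 (fun n κ' v κ u => if h : n = 0 then 0 else colH (coDressKBmAt (toSite (𝓻 n)) n (@KInvStep 3 n ⟨h⟩ 0)) n κ' v κ u) u n μ ν) ∧
      |B12Beta.secondMoment (RkFP 𝓻 (fun n κ' v κ u => if h : n = 0 then 0 else colH (coDressKBmAt (toSite (𝓻 n)) n (@KInvStep 3 n ⟨h⟩ 0)) n κ' v κ u) u n) μ ν|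
        ≤ CUfp (kappa163 4 / 16)
            (2 * ((MG163 4 * periodConst (kappa163 4) 3) * (1 + 8 * (1 + Real.exp (kappa163 4 / 4))) * Real.exp (kappa163 4 / 4)))
            ((MG163 4 * periodConst (kappa163 4) 3) * (1 + 8 * (1 + Real.exp (kappa163 4 / 4))) * Real.exp (kappa163 4 / 4)) u := by
  have hC₀ : 0 ≤ (MG163 4 * periodConst (kappa163 4) 3) * (1 + 8 * (1 + Real.exp (kappa163 4 / 4))) * Real.exp (kappa163 4 / 4) := by
    have h := colH_G₀_road_weight_nonneg 0
    have h1 : (0 : ℝ) < (((0 + 1 : ℕ) : ℝ) ^ 4)⁻¹ := by norm_num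
    exact (mul_nonneg_iff_of_pos_left h1).1 h
  refine rows_RkFP (Λ := fun _ => 2)
    (Cw := fun n => (((n : ℕ) : ℝ) ^ 4)⁻¹ * ((MG163 4 * periodConst (kappa163 4) 3) * (1 + 8 * (1 + Real.exp (kappa163 4 / 4))) * Real.exp (kappa163 4 / 4)))
    (div_pos (kappa163_pos 4) (by norm_num)) hr (fun _ => zero_le_two)
    (fun m κ u x => abs_bmGaugeAt_delta1_le_two (Nat.le_add_left 1 m) (toSite (𝓻 (m + 1))) κ u x)
    (fun m => colH_G₀_road_weight_nonneg m) (fun m => ?_) (fun m κ' v κ u => ?_) (fun m => units_line_G₀ m)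
  swap
  · rw [dif_neg (Nat.succ_ne_zero m)]
    exact colH_G₀_weight_rate m (hr m) κ' v κ u
  -- `Cw (m+1) ≤ Cw₀`: `((m+1)⁴)⁻¹ ≤ 1`
  have hn1 : (1 : ℝ) ≤ ((m + 1 : ℕ) : ℝ) := by exact_mod_cast Nat.le_add_left 1 m
  have h : ((((m + 1 : ℕ) : ℝ)) ^ 4)⁻¹ ≤ 1 := inv_le_one_of_one_le₀ (one_le_pow₀ hn1)
  calc ((((m + 1 : ℕ) : ℝ)) ^ 4)⁻¹ * ((MG163 4 * periodConst (kappa163 4) 3) * (1 + 8 * (1 + Real.exp (kappa163 4 / 4))) * Real.exp (kappa163 4 / 4))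
      ≤ 1 * ((MG163 4 * periodConst (kappa163 4) 3) * (1 + 8 * (1 + Real.exp (kappa163 4 / 4))) * Real.exp (kappa163 4 / 4)) :=
        mul_le_mul_of_nonneg_right h hC₀
    _ = _ := one_mul _

/-- [folklore] **THE FP LANE's END ROWS AT THE ROAD's WEIGHTS — NO ANALYTIC LETTER** (`RoadEndBFxDictPointwiseS.hdict_of_pointwise` at `υ := Unit`,
`Rk := RkFP 𝓻 𝓌_{G₀}`, any `[NeZero Lc]`): (i) `hMR`; (ii) READING (b) `hRu` with `Ru := 0`, `CU′ := CUfp (κ∕16) (2C_{G₀}) C_{G₀}`; (iii) READING (a)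
`hRu` with `CU′ := 0` and `hU` with the same `CU` at every `n ≥ 2`; (iv) the unit row at every `n ≥ 1` — right members independent of the scale. -/
theorem END_rows_RkFP_road {Lc : ℕ} [NeZero Lc] (hr : ∀ m : ℕ, 𝓻 (m + 1) ∈ box (3 + 1) (m + 1)) :
    (∀ (u : Unit) (m : ℕ), 1 ≤ m →
      AbsMoment₂ (RkFP 𝓻 (fun n κ' v κ u => if h : n = 0 then 0 else colH (coDressKBmAt (toSite (𝓻 n)) n (@KInvStep 3 n ⟨h⟩ 0)) n κ' v κ u) u (Lc ^ m) μ ν)) ∧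
    (∀ (u : Unit) (m : ℕ), 1 ≤ m →
      |B12Beta.secondMoment (RkFP 𝓻 (fun n κ' v κ u => if h : n = 0 then 0 else colH (coDressKBmAt (toSite (𝓻 n)) n (@KInvStep 3 n ⟨h⟩ 0)) n κ' v κ u) u (Lc ^ m)) μ ν
          - (fun (_ : Unit) (_ : ℕ) => (0 : ℝ)) u (Lc ^ m)|
        ≤ CUfp (kappa163 4 / 16)
            (2 * ((MG163 4 * periodConst (kappa163 4) 3) * (1 + 8 * (1 + Real.exp (kappa163 4 / 4))) * Real.exp (kappa163 4 / 4)))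
            ((MG163 4 * periodConst (kappa163 4) 3) * (1 + 8 * (1 + Real.exp (kappa163 4 / 4))) * Real.exp (kappa163 4 / 4)) u) ∧
    (∀ (u : Unit) (m : ℕ), 1 ≤ m →
      |B12Beta.secondMoment (RkFP 𝓻 (fun n κ' v κ u => if h : n = 0 then 0 else colH (coDressKBmAt (toSite (𝓻 n)) n (@KInvStep 3 n ⟨h⟩ 0)) n κ' v κ u) u (Lc ^ m)) μ ν
          - (fun (u : Unit) (n : ℕ) => B12Beta.secondMoment
              (RkFP 𝓻 (fun n κ' v κ u => if h : n = 0 then 0 else colH (coDressKBmAt (toSite (𝓻 n)) n (@KInvStep 3 n ⟨h⟩ 0)) n κ' v κ u) u n) μ ν) u (Lc ^ m)|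
        ≤ (fun _ : Unit => (0 : ℝ)) u) ∧
    (∀ n : ℕ, 2 ≤ n → ∀ u : Unit,
      |(fun (u : Unit) (n : ℕ) => B12Beta.secondMoment
          (RkFP 𝓻 (fun n κ' v κ u => if h : n = 0 then 0 else colH (coDressKBmAt (toSite (𝓻 n)) n (@KInvStep 3 n ⟨h⟩ 0)) n κ' v κ u) u n) μ ν) u n|
        ≤ CUfp (kappa163 4 / 16)
            (2 * ((MG163 4 * periodConst (kappa163 4) 3) * (1 + 8 * (1 + Real.exp (kappa163 4 / 4))) * Real.exp (kappa163 4 / 4)))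
            ((MG163 4 * periodConst (kappa163 4) 3) * (1 + 8 * (1 + Real.exp (kappa163 4 / 4))) * Real.exp (kappa163 4 / 4)) u) ∧
    (∀ (u : Unit) (n : ℕ), 1 ≤ n →
      |B12Beta.secondMoment (RkFP 𝓻 (fun n κ' v κ u => if h : n = 0 then 0 else colH (coDressKBmAt (toSite (𝓻 n)) n (@KInvStep 3 n ⟨h⟩ 0)) n κ' v κ u) u n) μ ν|
        ≤ CUfp (kappa163 4 / 16)
            (2 * ((MG163 4 * periodConst (kappa163 4) 3) * (1 + 8 * (1 + Real.exp (kappa163 4 / 4))) * Real.exp (kappa163 4 / 4)))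
            ((MG163 4 * periodConst (kappa163 4) 3) * (1 + 8 * (1 + Real.exp (kappa163 4 / 4))) * Real.exp (kappa163 4 / 4)) u) := by
  have hrows := rows_RkFP_road (𝓻 := 𝓻) (μ := μ) (ν := ν) hr
  have hLm : ∀ m : ℕ, 1 ≤ Lc ^ m := fun m => Nat.one_le_pow _ _ (Nat.pos_of_ne_zero (NeZero.ne Lc))
  refine ⟨fun u m _ => (hrows u (Lc ^ m) (hLm m)).1, fun u m _ => ?_, fun u m _ => ?_, fun n hn u => ?_, fun u n hn => (hrows u n hn).2⟩
  · rw [sub_zero]; exact (hrows u (Lc ^ m) (hLm m)).2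
  · rw [sub_self, abs_zero]
  · exact (hrows u n ((Nat.le_succ 1).trans hn)).2

end Summit.QuantumFields.BalabanUV.Beta.D1BFx.RestKernelFPSlotRoad

end
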